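import Summits.ResolutionOfSingularities.ResolutionOfSingularities.Theorems.FrobeniusLadderFInjectiveMacaulayficationTauFloorOneXChartIdent
import Summits.ResolutionOfSingularities.ResolutionOfSingularities.Theorems.FrobeniusLadderFInjectiveMacaulayficationDoublePointFermatCubicGerm
import Summits.ResolutionOfSingularities.ResolutionOfSingularities.Theorems.FrobeniusLadderFInjectiveMacaulayficationE8Char5FiModel
import Summits.ResolutionOfSingularities.ResolutionOfSingularities.Theorems.FrobeniusLadderFInjectiveMacaulayficationWFixAtNonClosedDimTwo
import Summits.ResolutionOfSingularities.ResolutionOfSingularities.Theorems.FrobeniusLadderFInjectiveMacaulayficationFiLocusOpenOfAffine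
import HarnessLib

/-!
# F4POS-1 (d-D1′): the chart facts of floor 1 of the τ-tower on `D(x̄²)`, transported to the Rees chart ring `A₀[τ/x̄²]` at EVERY prime
# (crux `FInjectiveMacaulayfication` stmt-ResolutionOfSingularities-15315, chain w45a; res-L1-w45a-plan-1 R18.17 (b)/R18.18 «F4POS-1 (d)»; the `D(x̄²)` twin of
# res-L1-w45a-stub-1's `…TauFloorOneChartYTransport` (p622179), same method; seat res-L1-w45a-stub-2 g8)

[OURS · L1 W4.5a] Support file (`--supports stmt-ResolutionOfSingularities-15315 --as helper`); def-free, unconditional; replaces the role of NO printed item;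
NOT a statement of the manuscript; AI-written (AI review is weaker than expert review).

`A₀ = k[X₀..X₄]/(f)` (P2d4C, char 2), `τ = (x̄², ȳ, ū, t̄, z̄)`. Along `TauFloorOneXChartIdent.exists_chartEquiv : C′ ≃+* blowupAlgebra τ (x̄²)` (`C′ = k[X]/(F′)`,
`F′ = X₄² + X₀²X₄ + X₀²(X₁³+X₂³+X₃³)`) with `E8Char5FiModel.nonempty_ringEquiv_localization_comap` for the localisations:
* ★ `cmCl_localization_blowupAlgebra` — the CM clause at EVERY prime of the chart ring `A₀[τ/x̄²]` (`C′` is a hypersurface: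
  `DoublePointFermatCubicGerm.cmCl_localization_hypersurface`; any field);
* ★★ `not_fullCl_localization_blowupAlgebra` — `¬ FullCl 2` at EVERY prime containing `x̄/1` (the exceptional divisor `V(τ·𝒪) = V(x̄²) = V(x̄)` of the chart;
  in `C′`, `x̄ ∈ 𝔮 ⇒ z̄′ ∈ 𝔮` since `z̄′² = x̄²·(−(z̄′ + ȳ³+ū³+t̄³))`; from `TauFloorOneNotFull.not_fullCl_stalk_of_mem_VXZ`, p615290).
So on the principal chart the WHOLE exceptional divisor is non-FULL (3-dimensional), and the chart is CM everywhere. The further transport to the Proj chart ring and the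
`S′`-level assembly of the four F-half input binders are res-L1-w45a-stub-1's (d-D2). [folklore transport]
-/

-- single-problem summit: the doubled namespace component is forced
set_option linter.dupNamespace false

noncomputable section

namespace Summit.ResolutionOfSingularities.ResolutionOfSingularities.Theorems.FInjectiveMacaulayfication.TauFloorOneChartXTransport

open MvPolynomial IsLocalRing Literature.AlgebraicGeometry.Resolution AlgebraicGeometry
open Summit.ResolutionOfSingularities.ResolutionOfSingularities.Theorems.FInjectiveMacaulayfication
open SliceableCentre

variable (k : Type) [Field k] (f : MvPolynomial (Fin 5) k) (hf : f = X 4 ^ 2 + X 0 ^ 4 * X 4 + X 1 ^ 3 + X 2 ^ 3 + X 3 ^ 3)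

/-! ## §1 In `C′`: a prime containing `x̄` contains `z̄′` -/

/-- In `C′`: `x̄ ∈ 𝔮 ⇒ z̄′ ∈ 𝔮` for a prime `𝔮` (`z̄′² = x̄²·(−(z̄′ + ȳ³+ū³+t̄³))`). [plumbing] -/
theorem mem_of_mem_x (F' : MvPolynomial (Fin 5) k) (hF : F' = X 4 ^ 2 + X 0 ^ 2 * X 4 + X 0 ^ 2 * (X 1 ^ 3 + X 2 ^ 3 + X 3 ^ 3))
    (Q : Ideal (MvPolynomial (Fin 5) k ⧸ Ideal.span {F'})) [Q.IsPrime] (hx : Ideal.Quotient.mk (Ideal.span {F'}) (X 0) ∈ Q) :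
    Ideal.Quotient.mk (Ideal.span {F'}) (X 4) ∈ Q := by
  refine ‹Q.IsPrime›.mem_of_pow_mem 2 ?_
  rw [TauFloorOneNotFull.sq_z_eq k F' hF]
  exact Q.mul_mem_right _ (Q.pow_mem_of_mem hx 2 (by norm_num))

/-! ## §2 The affine blow-up algebra `blowupAlgebra τ (x̄²)` -/

include hf in
/-- ★ **CM at every prime of `A₀[τ/x̄²]`** (`C′` is a hypersurface). [folklore transport; cite: Matsumura1987, Thm. 17.8] -/
theorem cmCl_localization_blowupAlgebra
    (Q : Ideal (blowupAlgebra (Ideal.span {Ideal.Quotient.mk (Ideal.span {f}) (X 0) ^ 2, Ideal.Quotient.mk (Ideal.span {f}) (X 1),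
      Ideal.Quotient.mk (Ideal.span {f}) (X 2), Ideal.Quotient.mk (Ideal.span {f}) (X 3), Ideal.Quotient.mk (Ideal.span {f}) (X 4)} :
        Ideal (MvPolynomial (Fin 5) k ⧸ Ideal.span {f})) (Ideal.Quotient.mk (Ideal.span {f}) (X 0) ^ 2))) [Q.IsPrime] :
    CMCl (Localization.AtPrime Q) := by
  obtain ⟨e, -⟩ := TauFloorOneXChartIdent.exists_chartEquiv k f hf (X 4 ^ 2 + X 0 ^ 2 * X 4 + X 0 ^ 2 * (X 1 ^ 3 + X 2 ^ 3 + X 3 ^ 3)) rfl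
  obtain ⟨eQ⟩ := E8Char5FiModel.nonempty_ringEquiv_localization_comap e Q
  haveI : (Q.comap e.toRingHom).IsPrime := Ideal.IsPrime.comap _
  have hF0 : (X 4 ^ 2 + X 0 ^ 2 * X 4 + X 0 ^ 2 * (X 1 ^ 3 + X 2 ^ 3 + X 3 ^ 3) : MvPolynomial (Fin 5) k) ≠ 0 := by
    intro h
    have := congrArg (MvPolynomial.eval (Pi.single 4 1 : Fin 5 → k)) h
    simp at this
  let w : Spec (.of (MvPolynomial (Fin 5) k ⧸ Ideal.span {(X 4 ^ 2 + X 0 ^ 2 * X 4 + X 0 ^ 2 * (X 1 ^ 3 + X 2 ^ 3 + X 3 ^ 3) :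
      MvPolynomial (Fin 5) k)})) := ⟨Q.comap e.toRingHom, inferInstance⟩
  exact FiLocusOpenOfAffine.cmClause_of_ringEquiv eQ (DoublePointFermatCubicGerm.cmCl_localization_hypersurface k _ hF0 w)

set_option maxHeartbeats 400000 in
include hf in
/-- ★★ **`¬ FullCl 2` at every prime of `A₀[τ/x̄²]` containing `x̄/1`** (the exceptional divisor of the chart `D(x̄²)`: there `τ·A₀[τ/x̄²] = (x̄²)`).
[folklore transport of p615290] -/
theorem not_fullCl_localization_blowupAlgebra [CharP k 2]
    (Q : Ideal (blowupAlgebra (Ideal.span {Ideal.Quotient.mk (Ideal.span {f}) (X 0) ^ 2, Ideal.Quotient.mk (Ideal.span {f}) (X 1),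
      Ideal.Quotient.mk (Ideal.span {f}) (X 2), Ideal.Quotient.mk (Ideal.span {f}) (X 3), Ideal.Quotient.mk (Ideal.span {f}) (X 4)} :
        Ideal (MvPolynomial (Fin 5) k ⧸ Ideal.span {f})) (Ideal.Quotient.mk (Ideal.span {f}) (X 0) ^ 2))) [Q.IsPrime]
    (hx : algebraMap (MvPolynomial (Fin 5) k ⧸ Ideal.span {f}) _ (Ideal.Quotient.mk (Ideal.span {f}) (X 0)) ∈ Q) :
    ¬ FullCl 2 (Localization.AtPrime Q) := by
  intro hfull
  obtain ⟨e, he⟩ := TauFloorOneXChartIdent.exists_chartEquiv k f hf (X 4 ^ 2 + X 0 ^ 2 * X 4 + X 0 ^ 2 * (X 1 ^ 3 + X 2 ^ 3 + X 3 ^ 3)) rfl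
  obtain ⟨eQ⟩ := E8Char5FiModel.nonempty_ringEquiv_localization_comap e Q
  haveI : (Q.comap e.toRingHom).IsPrime := Ideal.IsPrime.comap _
  -- `x̄ ∈ e⁻¹Q` (since `e x̄ = x̄/1`), hence `z̄′ ∈ e⁻¹Q`
  have hex : e (Ideal.Quotient.mk _ (X 0)) = algebraMap (MvPolynomial (Fin 5) k ⧸ Ideal.span {f}) _ (Ideal.Quotient.mk (Ideal.span {f}) (X 0)) :=
    Subtype.ext (he 0)
  have hxC : Ideal.Quotient.mk (Ideal.span {(X 4 ^ 2 + X 0 ^ 2 * X 4 + X 0 ^ 2 * (X 1 ^ 3 + X 2 ^ 3 + X 3 ^ 3) : MvPolynomial (Fin 5) k)})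
      (X 0) ∈ Q.comap e.toRingHom := by
    rw [Ideal.mem_comap, RingEquiv.toRingHom_eq_coe, RingEquiv.coe_toRingHom, hex]; exact hx
  have hzC := mem_of_mem_x k _ rfl (Q.comap e.toRingHom) hxC
  -- the stalk of `Spec C′` at `e⁻¹Q` is not FULL; transport
  let w : Spec (.of (MvPolynomial (Fin 5) k ⧸ Ideal.span {(X 4 ^ 2 + X 0 ^ 2 * X 4 + X 0 ^ 2 * (X 1 ^ 3 + X 2 ^ 3 + X 3 ^ 3) :
      MvPolynomial (Fin 5) k)})) := ⟨Q.comap e.toRingHom, inferInstance⟩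
  have hbad := TauFloorOneNotFull.not_fullCl_stalk_of_mem_VXZ k _ rfl w hxC hzC
  exact hbad (WFixAtNonClosedDimTwo.fullCl_of_ringEquiv 2 (eQ.symm.trans (Spec.stalkIso (.of _) w).commRingCatIsoToRingEquiv.symm) hfull)

end Summit.ResolutionOfSingularities.ResolutionOfSingularities.Theorems.FInjectiveMacaulayfication.TauFloorOneChartXTransport

end
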